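import Mathlib
import Summits.MatrixMultiplication.MatrixMultiplication.Theorems.SnSubsetDichotomyPolynomialSlackOneDense
import Summits.MatrixMultiplication.MatrixMultiplication.Theorems.SnSubsetDichotomyPolynomialSlackSplitC
import Summits.MatrixMultiplication.MatrixMultiplication.Theorems.SnSubsetDichotomyPolynomialSlackKeptSplitABC
import Summits.MatrixMultiplication.MatrixMultiplication.Theorems.SnSubsetDichotomyPolynomialSlackFrobeniusFloor
import Summits.MatrixMultiplication.MatrixMultiplication.Theorems.SnSubsetDichotomyPolynomialSlackStubSplit
import Literature.Combinatorics.Additive.TPPGroupAlgebra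

/-!
# Beyond one half: the structure theorem for pure violators

Crux `Summit.MatrixMultiplication.MatrixMultiplication.Theses.SnSubsetDichotomy.PolynomialSlack`
(item `stmt-MatrixMultiplication-8306`), level-one programme, lead c6 ("beyond one half"). A parity-pure
TPP triple `S, T, U ⊆ S_n` which VIOLATES the crux inequality at exponent `C₁` up to the constant `8`
(`n!√(n!) ≤ 8·|S||T||U|·n^{C₁}`, i.e. `F := n!√(n!)/N ≤ 8n^{C₁}`) fibres over `S_{n-1}` with a polynomial
loss: for every bound `B` on the TPP volumes of `S_{n-1}`,

  `|S||T||U| ≤ (100Λ³(64n²M³)²/(n-1)³ + n(1024nM³)²/(n-1)²)·B`,  `Λ = 200(1+log n)log(256n³)`,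

for every scale `M ≥ 1` with `16384M³ ≤ n-1` for which the explicit error terms are small
(`pure_violator_volume_le`). Proof: the co-densities `K_A, K_B, K_C` of the three quotient sets multiply to
`F² ≥ (n-1)/4` (`frobenius_floor`), so not all three are `< 16M`; if none is, `one_le_error_of_split_ABC`
contradicts the smallness; if exactly one is, rotate it into the `A` slot and use `volume_le_of_one_dense`;
if exactly two are, rotate the third into the `C` slot and use `volume_le_of_two_dense`.
-/

namespace Summit.MatrixMultiplication.MatrixMultiplication.Theorems.PolynomialSlack

open scoped BigOperators
open Literature.Combinatorics.Additive (TripleProductProperty)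

-- `Summit.<Summit>.<Problem>` is the tree's mandated summit-side namespace (CONVENTIONS §2); for
-- this single-conjunct summit the two coincide, so each declaration silences `dupNamespace`.
set_option linter.dupNamespace false

/-- The explicit level-one error is at most `F·(√6/√(n(n-1)) + 30√(GL/M)/√(n-1))`, `F = n!√(n!)/N`:
the two pinning terms are `≤ F√6/(2√(n(n-1)))` each (as `n(n-1)/6 ≤ n!`), and `√100 = 10`. [folklore] -/
theorem levelOneError_le {n : ℕ} (hn : 2 ≤ n) (N G L M : ℝ) (hN : 0 < N) :
    (n.factorial : ℝ) / (2 * N) +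
        (n.factorial : ℝ) * Real.sqrt (n.factorial : ℝ) / (2 * N * Real.sqrt (((n * (n - 1) : ℕ) : ℝ) / 6)) +
        3 * Real.sqrt (100 * G * L / M) * ((n.factorial : ℝ) * Real.sqrt (n.factorial : ℝ) / N) /
          Real.sqrt ((n : ℝ) - 1) ≤
      (n.factorial : ℝ) * Real.sqrt (n.factorial : ℝ) / N *
        (Real.sqrt 6 / Real.sqrt ((n : ℝ) * ((n : ℝ) - 1)) + 30 * Real.sqrt (G * L / M) / Real.sqrt ((n : ℝ) - 1)) := by
  have hn1 : 1 ≤ n := by omega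
  have hnR : (2 : ℝ) ≤ n := by exact_mod_cast hn
  have hm0 : (0 : ℝ) < (n : ℝ) - 1 := by linarith
  have hf0 : (0 : ℝ) < n.factorial := by exact_mod_cast n.factorial_pos
  have hD : Real.sqrt (((n * (n - 1) : ℕ) : ℝ) / 6) = Real.sqrt ((n : ℝ) * ((n : ℝ) - 1)) / Real.sqrt 6 := by
    have : (((n * (n - 1) : ℕ) : ℝ)) = (n : ℝ) * ((n : ℝ) - 1) := by
      push_cast [Nat.cast_sub hn1]; ring
    rw [this, Real.sqrt_div' _ (by norm_num : (0 : ℝ) ≤ 6)]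
  have hnn0 : 0 < (n : ℝ) * ((n : ℝ) - 1) := by positivity
  have hsnn : 0 < Real.sqrt ((n : ℝ) * ((n : ℝ) - 1)) := Real.sqrt_pos.2 hnn0
  have hs6 : 0 < Real.sqrt 6 := Real.sqrt_pos.2 (by norm_num)
  have hsf : Real.sqrt ((n : ℝ) * ((n : ℝ) - 1)) / Real.sqrt 6 ≤ Real.sqrt (n.factorial : ℝ) := by
    rw [div_le_iff₀ hs6, ← Real.sqrt_mul hf0.le]
    apply Real.sqrt_le_sqrt
    have hnf : (n : ℝ) * ((n : ℝ) - 1) ≤ n.factorial := by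
      have hh : n * (n - 1) ≤ n.factorial := by
        rw [← Nat.mul_factorial_pred (show n ≠ 0 by omega)]
        exact Nat.mul_le_mul_left n (Nat.self_le_factorial _)
      have e : ((n * (n - 1) : ℕ) : ℝ) = (n : ℝ) * ((n : ℝ) - 1) := by
        push_cast [Nat.cast_sub hn1]; ring
      rw [← e]; exact_mod_cast hh
    linarith [hnf, hf0.le]
  obtain ⟨q, hq⟩ : ∃ q : ℝ, q = Real.sqrt 6 / Real.sqrt ((n : ℝ) * ((n : ℝ) - 1)) := ⟨_, rfl⟩
  have hq0 : 0 < q := by rw [hq]; positivity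
  have hq1 : 1 ≤ Real.sqrt (n.factorial : ℝ) * q := by
    rw [hq, mul_div_assoc', le_div_iff₀ hsnn, one_mul]
    calc Real.sqrt ((n : ℝ) * ((n : ℝ) - 1))
        = Real.sqrt ((n : ℝ) * ((n : ℝ) - 1)) / Real.sqrt 6 * Real.sqrt 6 := by field_simp
      _ ≤ Real.sqrt (n.factorial : ℝ) * Real.sqrt 6 := mul_le_mul_of_nonneg_right hsf hs6.le
  have e1 : (n.factorial : ℝ) * Real.sqrt (n.factorial : ℝ) /
      (2 * N * (Real.sqrt ((n : ℝ) * ((n : ℝ) - 1)) / Real.sqrt 6)) =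
      (n.factorial : ℝ) * Real.sqrt (n.factorial : ℝ) / N * q / 2 := by
    rw [hq]; field_simp
  have e2 : (n.factorial : ℝ) / (2 * N) ≤ (n.factorial : ℝ) * Real.sqrt (n.factorial : ℝ) / N * q / 2 := by
    rw [div_le_iff₀ (by positivity)]
    have h1 : (n.factorial : ℝ) ≤ (n.factorial : ℝ) * (Real.sqrt (n.factorial : ℝ) * q) := by
      have := mul_le_mul_of_nonneg_left hq1 hf0.le; linarith [this]
    calc (n.factorial : ℝ) ≤ (n.factorial : ℝ) * (Real.sqrt (n.factorial : ℝ) * q) := h1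
      _ = (n.factorial : ℝ) * Real.sqrt (n.factorial : ℝ) / N * q / 2 * (2 * N) := by field_simp
  have e3 : Real.sqrt (100 * G * L / M) = 10 * Real.sqrt (G * L / M) := by
    rw [show 100 * G * L / M = 10 ^ 2 * (G * L / M) by ring, Real.sqrt_mul (by norm_num),
      Real.sqrt_sq (by norm_num)]
  rw [hD, e1, e3, ← hq]
  have e4 : 3 * (10 * Real.sqrt (G * L / M)) * ((n.factorial : ℝ) * Real.sqrt (n.factorial : ℝ) / N) /
      Real.sqrt ((n : ℝ) - 1) = (n.factorial : ℝ) * Real.sqrt (n.factorial : ℝ) / N *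
        (30 * Real.sqrt (G * L / M) / Real.sqrt ((n : ℝ) - 1)) := by ring
  rw [e4]
  nlinarith [e2]

set_option maxHeartbeats 1600000 in
/-- **Structure theorem for pure violators.** For `n ≥ 40`, `C₁ ≤ 1`, `1 ≤ M` with `16384M³ ≤ n-1`, a
parity-pure TPP triple of non-empty sets with `n!√(n!) ≤ 8|S||T||U|n^{C₁}`, and small explicit error
terms (the hypothesis `hsmall`), every bound `B` on the TPP volumes of `S_{n-1}` gives
`|S||T||U| ≤ (100Λ³(64n²M³)²/(n-1)³ + n(1024nM³)²/(n-1)²)·B`, `Λ = 200(1+log n)log(256n³)`. [folklore] -/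
theorem pure_violator_volume_le {n : ℕ} (hn : 40 ≤ n) (B : ℕ)
    (hB : ∀ S' T' U' : Finset (Equiv.Perm (Fin (n - 1))), TripleProductProperty S' T' U' →
      S'.card * T'.card * U'.card ≤ B)
    {S T U : Finset (Equiv.Perm (Fin n))} (hTPP : TripleProductProperty S T U)
    (hS0 : S.Nonempty) (hT0 : T.Nonempty) (hU0 : U.Nonempty)
    (hS : ∀ s ∈ S, ∀ s' ∈ S, Equiv.Perm.sign s = Equiv.Perm.sign s')
    (hT : ∀ t ∈ T, ∀ t' ∈ T, Equiv.Perm.sign t = Equiv.Perm.sign t')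
    (hU : ∀ u ∈ U, ∀ u' ∈ U, Equiv.Perm.sign u = Equiv.Perm.sign u')
    (C₁ M : ℝ) (hC₁ : C₁ ≤ 1) (hM : 1 ≤ M)
    (hviol : (n.factorial : ℝ) * Real.sqrt (n.factorial : ℝ) ≤
      8 * (S.card * T.card * U.card : ℕ) * (n : ℝ) ^ C₁)
    (hM3 : 16384 * M ^ 3 ≤ (n : ℝ) - 1)
    (hsmall : 8 * (n : ℝ) ^ C₁ * (Real.sqrt 6 / Real.sqrt ((n : ℝ) * ((n : ℝ) - 1)) +
        30 * Real.sqrt ((1 + Real.log n) * Real.log (256 * (n : ℝ) ^ 3) / M) / Real.sqrt ((n : ℝ) - 1)) +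
        8 * (200 * (1 + Real.log n) * Real.log (256 * (n : ℝ) ^ 3)) ^ 2 * M ^ 2 * Real.sqrt M * n /
          (((n : ℝ) - 1) * Real.sqrt ((n : ℝ) - 1)) ≤
        1 / (64 * (200 * (1 + Real.log n) * Real.log (256 * (n : ℝ) ^ 3)) ^ 2)) :
    ((S.card * T.card * U.card : ℕ) : ℝ) ≤
      (100 * (200 * (1 + Real.log n) * Real.log (256 * (n : ℝ) ^ 3)) ^ 3 * (64 * (n : ℝ) ^ 2 * M ^ 3) ^ 2 /
          ((n : ℝ) - 1) ^ 3 + (n : ℝ) * (1024 * (n : ℝ) * M ^ 3) ^ 2 / ((n : ℝ) - 1) ^ 2) * B := by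
  classical
  /- scalars -/
  have hn1 : 1 ≤ n := by omega
  have hn2 : 2 ≤ n := by omega
  have hnR : (40 : ℝ) ≤ n := by exact_mod_cast hn
  have hn0 : (0 : ℝ) < n := by linarith
  have hm0 : (0 : ℝ) < (n : ℝ) - 1 := by linarith
  have hM0 : 0 < M := by linarith
  have hf0 : (0 : ℝ) < n.factorial := by exact_mod_cast n.factorial_pos
  have hG0 : 0 ≤ 1 + Real.log n := by
    have := Real.log_nonneg (show (1 : ℝ) ≤ n by linarith); linarith
  have hL1 : 1 ≤ Real.log (256 * (n : ℝ) ^ 3) := by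
    rw [← Real.log_exp 1]
    apply Real.log_le_log (Real.exp_pos 1)
    have h3 : (1 : ℝ) ≤ (n : ℝ) ^ 3 := one_le_pow₀ (by linarith)
    linarith [Real.exp_one_lt_d9]
  set Λ : ℝ := 200 * (1 + Real.log n) * Real.log (256 * (n : ℝ) ^ 3) with hΛ
  have hΛ1 : 1 ≤ Λ := by
    rw [hΛ]
    have hG1 : 1 ≤ 1 + Real.log n := by linarith [Real.log_nonneg (show (1 : ℝ) ≤ n by linarith)]
    have : (1 : ℝ) * 1 ≤ (1 + Real.log n) * Real.log (256 * (n : ℝ) ^ 3) :=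
      mul_le_mul hG1 hL1 zero_le_one hG0
    linarith
  -- the volume and the pair sizes, as reals
  have hcS0 : (0 : ℝ) < S.card := by exact_mod_cast hS0.card_pos
  have hcT0 : (0 : ℝ) < T.card := by exact_mod_cast hT0.card_pos
  have hcU0 : (0 : ℝ) < U.card := by exact_mod_cast hU0.card_pos
  obtain ⟨N, hNdef⟩ : ∃ N : ℝ, N = (S.card : ℝ) * T.card * U.card := ⟨_, rfl⟩
  have hN0 : 0 < N := by rw [hNdef]; positivity
  have hNe : ((S.card * T.card * U.card : ℕ) : ℝ) = N := by rw [hNdef]; push_cast; ring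
  have hNe' : ((T.card * U.card * S.card : ℕ) : ℝ) = N := by rw [hNdef]; push_cast; ring
  have hNe'' : ((U.card * S.card * T.card : ℕ) : ℝ) = N := by rw [hNdef]; push_cast; ring
  obtain ⟨F, hFdef⟩ : ∃ F : ℝ, F = (n.factorial : ℝ) * Real.sqrt (n.factorial : ℝ) / N := ⟨_, rfl⟩
  have hF0 : 0 < F := by rw [hFdef]; positivity
  have hF8 : F ≤ 8 * (n : ℝ) ^ C₁ := by
    rw [hFdef, div_le_iff₀ hN0]; rw [hNe] at hviol; linarith
  -- the three injectivities and pair sizes `≤ n!`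
  have hinjA := injOn_quot_first hTPP hU0
  have hinjB := injOn_quot_second hTPP hS0
  have hinjC := injOn_quot_first hTPP.rotate.rotate hT0
  have hαle : ((S.card * T.card : ℕ) : ℝ) ≤ n.factorial := by
    exact_mod_cast card_mul_card_le_factorial_of_injOn hinjA
  have hβle : ((T.card * U.card : ℕ) : ℝ) ≤ n.factorial := by
    exact_mod_cast card_mul_card_le_factorial_of_injOn hinjB
  have hγle : ((U.card * S.card : ℕ) : ℝ) ≤ n.factorial := by
    exact_mod_cast card_mul_card_le_factorial_of_injOn hinjC
  have hα0 : (0 : ℝ) < (S.card * T.card : ℕ) := by push_cast; positivity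
  have hβ0 : (0 : ℝ) < (T.card * U.card : ℕ) := by push_cast; positivity
  have hγ0 : (0 : ℝ) < (U.card * S.card : ℕ) := by push_cast; positivity
  -- the co-densities
  obtain ⟨KA, hKA⟩ : ∃ K : ℝ, K = (n.factorial : ℝ) / (S.card * T.card : ℕ) := ⟨_, rfl⟩
  obtain ⟨KB, hKB⟩ : ∃ K : ℝ, K = (n.factorial : ℝ) / (T.card * U.card : ℕ) := ⟨_, rfl⟩
  obtain ⟨KC, hKC⟩ : ∃ K : ℝ, K = (n.factorial : ℝ) / (U.card * S.card : ℕ) := ⟨_, rfl⟩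
  have hKA0 : 0 < KA := by rw [hKA]; positivity
  have hKB0 : 0 < KB := by rw [hKB]; positivity
  have hKC0 : 0 < KC := by rw [hKC]; positivity
  have hprod : ((S.card * T.card : ℕ) : ℝ) * (T.card * U.card : ℕ) * (U.card * S.card : ℕ) = N ^ 2 := by
    rw [hNdef]; push_cast; ring
  have hKKK : KA * KB * KC = F ^ 2 := by
    rw [hKA, hKB, hKC, hFdef, div_pow, mul_pow, Real.sq_sqrt hf0.le, ← hprod]
    field_simp
  -- `K_X ≤ F²`, hence the pair logarithms are `≤ log(256 n³)`
  have hn2C : (n : ℝ) ^ C₁ * (n : ℝ) ^ C₁ ≤ (n : ℝ) ^ 2 := by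
    rw [← Real.rpow_add hn0]
    have h := Real.rpow_le_rpow_of_exponent_le (show (1 : ℝ) ≤ n by linarith)
      (show C₁ + C₁ ≤ ((2 : ℕ) : ℝ) by push_cast; linarith)
    rwa [Real.rpow_natCast] at h
  have hF2up : F ^ 2 ≤ 64 * (n : ℝ) ^ 2 := by
    have h0 : 0 ≤ 8 * (n : ℝ) ^ C₁ := by positivity
    calc F ^ 2 = F * F := sq F
      _ ≤ (8 * (n : ℝ) ^ C₁) * (8 * (n : ℝ) ^ C₁) := mul_le_mul hF8 hF8 hF0.le h0
      _ = 64 * ((n : ℝ) ^ C₁ * (n : ℝ) ^ C₁) := by ring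
      _ ≤ 64 * (n : ℝ) ^ 2 := by linarith
  have hlogK : ∀ (K ζ : ℝ), K = (n.factorial : ℝ) / ζ → 0 < ζ → K ≤ F ^ 2 →
      Real.log (4 * n * n.factorial / ζ) ≤ Real.log (256 * (n : ℝ) ^ 3) := by
    intro K ζ hK hζ hKF
    have e : 4 * (n : ℝ) * n.factorial / ζ = 4 * n * K := by rw [hK]; ring
    rw [e]
    apply Real.log_le_log (by rw [hK]; positivity)
    have : 4 * (n : ℝ) * K ≤ 4 * n * (64 * (n : ℝ) ^ 2) :=
      mul_le_mul_of_nonneg_left (hKF.trans hF2up) (by positivity)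
    nlinarith
  have hKAF : KA ≤ F ^ 2 := by
    rw [← hKKK]
    have h1 : 1 ≤ KB := by rw [hKB, le_div_iff₀ hβ0]; linarith
    have h2 : 1 ≤ KC := by rw [hKC, le_div_iff₀ hγ0]; linarith
    calc KA = KA * 1 * 1 := by ring
      _ ≤ KA * KB * KC := by gcongr
  have hKBF : KB ≤ F ^ 2 := by
    rw [← hKKK]
    have h1 : 1 ≤ KA := by rw [hKA, le_div_iff₀ hα0]; linarith
    have h2 : 1 ≤ KC := by rw [hKC, le_div_iff₀ hγ0]; linarith
    calc KB = 1 * KB * 1 := by ring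
      _ ≤ KA * KB * KC := by gcongr
  have hKCF : KC ≤ F ^ 2 := by
    rw [← hKKK]
    have h1 : 1 ≤ KA := by rw [hKA, le_div_iff₀ hα0]; linarith
    have h2 : 1 ≤ KB := by rw [hKB, le_div_iff₀ hβ0]; linarith
    calc KC = 1 * 1 * KC := by ring
      _ ≤ KA * KB * KC := by gcongr
  have hLA := hlogK KA _ hKA hα0 hKAF
  have hLB := hlogK KB _ hKB hβ0 hKBF
  have hLC := hlogK KC _ hKC hγ0 hKCF
  /- the level-one error and the Frobenius floor -/
  have herr := levelOneError_le hn2 N (1 + Real.log n) (Real.log (256 * (n : ℝ) ^ 3)) M hN0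
  rw [← hFdef] at herr
  have hq0 : 0 ≤ Real.sqrt 6 / Real.sqrt ((n : ℝ) * ((n : ℝ) - 1)) +
      30 * Real.sqrt ((1 + Real.log n) * Real.log (256 * (n : ℝ) ^ 3) / M) / Real.sqrt ((n : ℝ) - 1) := by
    positivity
  have hδ₄0 : 0 ≤ 8 * Λ ^ 2 * M ^ 2 * Real.sqrt M * n / (((n : ℝ) - 1) * Real.sqrt ((n : ℝ) - 1)) := by
    positivity
  have h64 : 1 / (64 * Λ ^ 2) ≤ 1 / 64 := by
    apply div_le_div_of_nonneg_left (by norm_num) (by norm_num)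
    nlinarith
  -- `δ_expr ≤ δmax ≤ 1/64`
  have hδlt : (n.factorial : ℝ) / (2 * N) +
      (n.factorial : ℝ) * Real.sqrt (n.factorial : ℝ) / (2 * N * Real.sqrt (((n * (n - 1) : ℕ) : ℝ) / 6)) +
      3 * Real.sqrt (100 * (1 + Real.log n) * Real.log (256 * (n : ℝ) ^ 3) / M) * F /
        Real.sqrt ((n : ℝ) - 1) ≤ 1 / 64 := by
    have h1 := mul_le_mul_of_nonneg_right hF8 hq0
    linarith
  -- `δ₀ ≤ 1/2` and the floor `F² ≥ (n-1)/4`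
  have hfloor := frobenius_floor hn hTPP hS0 hT0 hU0 hS hT hU
  rw [hNe, ← hFdef] at hfloor
  have hterm3 : 0 ≤ 3 * Real.sqrt (100 * (1 + Real.log n) * Real.log (256 * (n : ℝ) ^ 3) / M) * F /
      Real.sqrt ((n : ℝ) - 1) := by positivity
  have hδ0 : (n.factorial : ℝ) / (2 * N) +
      (n.factorial : ℝ) * Real.sqrt (n.factorial : ℝ) / (2 * N * Real.sqrt (((n * (n - 1) : ℕ) : ℝ) / 6)) ≤
      1 / 2 := by linarith
  have hsq1 : Real.sqrt ((n : ℝ) - 1) ^ 2 = (n : ℝ) - 1 := Real.sq_sqrt hm0.le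
  have hF2 : ((n : ℝ) - 1) / 4 ≤ F ^ 2 := by
    have h1 : (1 / 2) * Real.sqrt ((n : ℝ) - 1) ≤ F := by
      refine le_trans ?_ hfloor
      exact mul_le_mul_of_nonneg_right (by linarith) (Real.sqrt_nonneg _)
    have h2 : 0 ≤ (1 / 2) * Real.sqrt ((n : ℝ) - 1) := by positivity
    nlinarith [mul_le_mul h1 h1 h2 hF0.le]
  /- not all three quotients are dense -/
  have hnot3 : ¬ (KA < 16 * M ∧ KB < 16 * M ∧ KC < 16 * M) := by
    rintro ⟨hA, hB', hC⟩
    have h1 : KA * KB * KC < 16 * M * (16 * M) * (16 * M) := by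
      have h2 : KA * KB < 16 * M * (16 * M) := mul_lt_mul'' hA hB' hKA0.le hKB0.le
      exact mul_lt_mul'' h2 hC (by positivity) hKC0.le
    rw [hKKK] at h1
    nlinarith
  /- the case analysis -/
  have hM' : 16 * M ≤ KA ∨ KA < 16 * M := le_or_gt _ _
  have hGpos : 0 ≤ (n : ℝ) * (1024 * (n : ℝ) * M ^ 3) ^ 2 / ((n : ℝ) - 1) ^ 2 * B := by positivity
  have hHpos : 0 ≤ 100 * Λ ^ 3 * (64 * (n : ℝ) ^ 2 * M ^ 3) ^ 2 / ((n : ℝ) - 1) ^ 3 * B := by positivity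
  rw [add_mul]
  -- hypotheses shared by all rotations
  have hF8' : (n.factorial : ℝ) * Real.sqrt (n.factorial : ℝ) / (S.card * T.card * U.card : ℕ) ≤
      8 * (n : ℝ) ^ C₁ := by rw [hNe, ← hFdef]; exact hF8
  have hF2' : ((n : ℝ) - 1) / 4 ≤
      ((n.factorial : ℝ) * Real.sqrt (n.factorial : ℝ) / (S.card * T.card * U.card : ℕ)) ^ 2 := by
    rw [hNe, ← hFdef]; exact hF2
  have hsmall2 : 8 * (n : ℝ) ^ C₁ * (Real.sqrt 6 / Real.sqrt ((n : ℝ) * ((n : ℝ) - 1)) +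
      30 * Real.sqrt ((1 + Real.log n) * Real.log (256 * (n : ℝ) ^ 3) / M) / Real.sqrt ((n : ℝ) - 1)) < 1 := by
    have h1 := mul_le_mul_of_nonneg_right hF8 hq0
    linarith
  rcases le_or_gt (16 * M) KA with hA | hA <;> rcases le_or_gt (16 * M) KB with hB' | hB' <;>
    rcases le_or_gt (16 * M) KC with hC | hC
  · -- no dense quotient: contradiction
    exfalso
    have h := one_le_error_of_split_ABC hn hTPP hS0 hT0 hU0 hS hT hU M (Real.log (256 * (n : ℝ) ^ 3)) hM
      hL1 (by rw [← hKA]; exact hA) (by rw [← hKB]; exact hB') (by rw [← hKC]; exact hC) hLA hLB hLC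
    rw [hNe, ← hFdef] at h
    linarith
  · -- only `C` dense: rotate twice, `(U, S, T)`
    have h := volume_le_of_one_dense hn B hB hTPP.rotate.rotate hU0 hS0 hT0 hU hS hT C₁ M hM
      (by rw [← hKC]; exact hC) (by rw [← hKA]; exact hA) (by rw [← hKB]; exact hB')
      (by rw [hNe'', ← hNe]; exact hF8') (by rw [hNe'', ← hNe]; exact hF2') hLA hLB hsmall
    rw [hNe''] at h; rw [hNe]; linarith
  · -- only `B` dense: rotate once, `(T, U, S)`
    have h := volume_le_of_one_dense hn B hB hTPP.rotate hT0 hU0 hS0 hT hU hS C₁ M hM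
      (by rw [← hKB]; exact hB') (by rw [← hKC]; exact hC) (by rw [← hKA]; exact hA)
      (by rw [hNe', ← hNe]; exact hF8') (by rw [hNe', ← hNe]; exact hF2') hLC hLA hsmall
    rw [hNe'] at h; rw [hNe]; linarith
  · -- `B, C` dense, `A` not: rotate once, `(T, U, S)` has its third quotient `A`
    have h := volume_le_of_two_dense hn B hB hTPP.rotate hT0 hU0 hS0 hT hU hS C₁ M hM
      (by rw [← hKB]; exact hB') (by rw [← hKC]; exact hC) (by rw [← hKA]; exact hA)
      (by rw [hNe', ← hNe]; exact hF8') (by rw [hNe', ← hNe]; exact hF2') hLA hsmall2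
    rw [hNe'] at h; rw [hNe]; linarith
  · -- only `A` dense
    have h := volume_le_of_one_dense hn B hB hTPP hS0 hT0 hU0 hS hT hU C₁ M hM
      (by rw [← hKA]; exact hA) (by rw [← hKB]; exact hB') (by rw [← hKC]; exact hC) hF8' hF2' hLB hLC
      hsmall
    rw [hNe] at h ⊢; linarith
  · -- `A, C` dense, `B` not: rotate twice, `(U, S, T)` has its third quotient `B`
    have h := volume_le_of_two_dense hn B hB hTPP.rotate.rotate hU0 hS0 hT0 hU hS hT C₁ M hM
      (by rw [← hKC]; exact hC) (by rw [← hKA]; exact hA) (by rw [← hKB]; exact hB')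
      (by rw [hNe'', ← hNe]; exact hF8') (by rw [hNe'', ← hNe]; exact hF2') hLB hsmall2
    rw [hNe''] at h; rw [hNe]; linarith
  · -- `A, B` dense, `C` not
    have h := volume_le_of_two_dense hn B hB hTPP hS0 hT0 hU0 hS hT hU C₁ M hM
      (by rw [← hKA]; exact hA) (by rw [← hKB]; exact hB') (by rw [← hKC]; exact hC) hF8' hF2' hLC hsmall2
    rw [hNe] at h ⊢; linarith
  · exact absurd ⟨hA, hB', hC⟩ hnot3

end Summit.MatrixMultiplication.MatrixMultiplication.Theorems.PolynomialSlack
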